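import Literature.Analysis.FunctionSpaces.ContDiffHolderCompactness
import Literature.Analysis.FunctionSpaces.HolderSpaceManifold
import HarnessLib

/-!
# Arzelà–Ascoli in `C^{k,r}_𝔄(M, F)` on a compact manifold (Hölder spaces, part 18)

Topic `Literature/Analysis/FunctionSpaces`. A norm-bounded sequence `uₙ` in the Hölder space
`C^{k,r}_𝔄(M, F)` of a compact manifold (part 4; `E`, `F` finite-dimensional, `0 < r`) has a
subsequence along which all derivatives of order `≤ k` of all chart pieces converge uniformly, to
the chart pieces of a limit `v ∈ C^{k,r}_𝔄(M, F)`
(`HolderManifoldFunction.exists_subseq_tendstoUniformly_of_norm_le`). Proof: the pieces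
`𝔄.piece uₙ i` are bounded by `‖uₙ‖` and supported in the fixed compact sets
`chart_i(tsupport ρ_i)`, so the Euclidean Arzelà–Ascoli of part 17 applies chart by chart
(iterated subsequence extraction over the finite index type); the limit function is rebuilt from the
limit pieces by `u x = ∑ i 𝟙_{source_i}(x) · piece_i u (chart_i x)` as in the completeness proof of
part 4. This is the compactness of `C^{k,α}(M) ↪ C^k(M)` (Gilbarg–Trudinger 2001, Lemma 6.36, on a
closed manifold); it feeds the surjectivity half of census item (2c) of
`Literature.Geometry.Riemannian.gurskyViaclovsky_pathOpen_weighted_four`. Everything is proved;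
no named facts.

## References

* D. Gilbarg, N. S. Trudinger, *Elliptic Partial Differential Equations of Second Order* (2001),
  Lemma 6.36. [GilbargTrudinger2001]
-/

noncomputable section

open Set Filter Topology Function
open scoped NNReal Manifold ContDiff

namespace Literature.Analysis.FunctionSpaces

namespace HolderManifoldFunction

variable {ι : Type*} [Fintype ι] {E : Type*} [NormedAddCommGroup E] [NormedSpace ℝ E]
  [FiniteDimensional ℝ E] {M : Type*} [TopologicalSpace M] [ChartedSpace E M] [CompactSpace M]
  {𝔄 : HolderChartData ι E M} {F : Type*} [NormedAddCommGroup F] [NormedSpace ℝ F]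
  [FiniteDimensional ℝ F] {k : ℕ} {r : ℝ≥0}

/-- Subsequences preserve uniform convergence. [folklore] -/
theorem _root_.Literature.Analysis.FunctionSpaces.tendstoUniformly_comp_strictMono {α β : Type*}
    [UniformSpace β] {G : ℕ → α → β} {g : α → β} (h : TendstoUniformly G g atTop) {ψ : ℕ → ℕ}
    (hψ : StrictMono ψ) : TendstoUniformly (fun n => G (ψ n)) g atTop :=
  fun s hs => hψ.tendsto_atTop.eventually (h s hs)

/-- **Chart-by-chart extraction**: for every finite set `s` of chart indices there is a subsequence
along which all derivatives of the `i`-th pieces, `i ∈ s`, converge uniformly to members of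
`C^{k,r}_b(E, F)`. [folklore] -/
theorem exists_subseq_tendstoUniformly_pieces (hr : 0 < r) (u : ℕ → HolderManifoldFunction 𝔄 F k r)
    {B : ℝ} (hB : ∀ n, ‖u n‖ ≤ B) (s : Finset ι) :
    ∃ φ : ℕ → ℕ, StrictMono φ ∧ ∃ g : ι → ContDiffHolderFunction E F k r, ∀ i ∈ s, ∀ j : ℕ, j ≤ k →
      TendstoUniformly (fun n => iteratedFDeriv ℝ j (𝔄.piece (u (φ n) : M → F) i))
        (iteratedFDeriv ℝ j (g i : E → F)) atTop := by
  classical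
  induction s using Finset.induction_on with
  | empty => exact ⟨id, strictMono_id, fun _ => 0, fun i hi => absurd hi (Finset.notMem_empty i)⟩
  | insert a s ha ih =>
    obtain ⟨φ, hφ, g, hg⟩ := ih
    -- Euclidean Arzelà–Ascoli for the `a`-th pieces along `φ`
    obtain ⟨hKc, hKt⟩ := 𝔄.isCompact_image_tsupport a
    obtain ⟨ψ, hψ, ga, -, hga⟩ := exists_subseq_tendstoUniformly_of_norm_le hr hKc
      (fun n => (u (φ n)).toPieces a) (B := B) (fun n => ((u (φ n)).norm_toPieces_le a).trans (hB _))
      (fun n => 𝔄.tsupport_piece_subset (u (φ n) : M → F) a)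
    refine ⟨φ ∘ ψ, hφ.comp hψ, Function.update g a ga, fun i hi j hj => ?_⟩
    rcases Finset.mem_insert.1 hi with rfl | hi'
    · rw [Function.update_self]
      exact hga j hj
    · rw [Function.update_of_ne (ne_of_mem_of_not_mem hi' ha)]
      exact tendstoUniformly_comp_strictMono (hg i hi' j hj) hψ

/-- **Arzelà–Ascoli in `C^{k,r}_𝔄(M, F)`**: a norm-bounded sequence (`0 < r`, `E`, `F`
finite-dimensional, `M` compact) has a subsequence along which all derivatives of order `≤ k` of all
chart pieces converge uniformly to the chart pieces of a limit in `C^{k,r}_𝔄(M, F)`; in particular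
the subsequence converges pointwise (indeed uniformly) to the limit. [cite: GilbargTrudinger2001, Lemma 6.36] -/
theorem exists_subseq_tendstoUniformly_of_norm_le (hr : 0 < r) (u : ℕ → HolderManifoldFunction 𝔄 F k r)
    {B : ℝ} (hB : ∀ n, ‖u n‖ ≤ B) :
    ∃ φ : ℕ → ℕ, StrictMono φ ∧ ∃ v : HolderManifoldFunction 𝔄 F k r,
      (∀ (i : ι) (j : ℕ), j ≤ k →
        TendstoUniformly (fun n => iteratedFDeriv ℝ j (𝔄.piece (u (φ n) : M → F) i))
          (iteratedFDeriv ℝ j (𝔄.piece (v : M → F) i)) atTop) ∧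
      ∀ x, Tendsto (fun n => u (φ n) x) atTop (𝓝 (v x)) := by
  obtain ⟨φ, hφ, g, hg⟩ := exists_subseq_tendstoUniformly_pieces hr u hB Finset.univ
  -- pointwise limits of the pieces
  have hval : ∀ (i : ι) (y : E), Tendsto (fun n => 𝔄.piece (u (φ n) : M → F) i y) atTop (𝓝 (g i y)) := by
    intro i y
    have h0 := (hg i (Finset.mem_univ i) 0 (Nat.zero_le k)).tendsto_at y
    rw [Metric.tendsto_atTop] at h0 ⊢
    intro ε hε
    obtain ⟨N, hN⟩ := h0 ε hε
    refine ⟨N, fun n hn => ?_⟩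
    have h := hN n hn
    rwa [iteratedFDeriv_zero_eq_comp, iteratedFDeriv_zero_eq_comp, Function.comp_apply,
      Function.comp_apply, LinearIsometryEquiv.dist_map] at h
  -- the limit function
  set v : M → F := fun x => ∑ i, (𝔄.chart i).source.indicator (fun x => g i (𝔄.chart i x)) x
    with hvdef
  have hv : ∀ x, Tendsto (fun n => u (φ n) x) atTop (𝓝 (v x)) := by
    intro x
    have hrepr : (fun n => u (φ n) x) = fun n => ∑ i,
        (𝔄.chart i).source.indicator (fun x => 𝔄.piece (u (φ n) : M → F) i (𝔄.chart i x)) x :=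
      funext fun n => 𝔄.apply_eq_sum_indicator_piece (u (φ n) : M → F) x
    rw [hrepr]
    refine tendsto_finsetSum _ fun i _ => ?_
    by_cases hx : x ∈ (𝔄.chart i).source
    · simp only [indicator_of_mem hx]
      exact hval i _
    · simp only [indicator_of_notMem hx]
      exact tendsto_const_nhds
  -- its pieces are the limits of the pieces
  have hpiece : ∀ i, 𝔄.piece v i = (g i : E → F) := by
    intro i
    funext y
    by_cases hy : y ∈ (𝔄.chart i).target
    · rw [𝔄.piece_apply_of_mem v hy]
      have h1 : Tendsto (fun n => 𝔄.ρ i ((𝔄.chart i).symm y) • u (φ n) ((𝔄.chart i).symm y)) atTop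
          (𝓝 (𝔄.ρ i ((𝔄.chart i).symm y) • v ((𝔄.chart i).symm y))) :=
        (hv _).const_smul _
      have h2 : Tendsto (fun n => 𝔄.ρ i ((𝔄.chart i).symm y) • u (φ n) ((𝔄.chart i).symm y)) atTop
          (𝓝 (g i y)) := by
        refine (hval i y).congr fun n => ?_
        exact 𝔄.piece_apply_of_mem (u (φ n) : M → F) hy
      exact tendsto_nhds_unique h1 h2
    · rw [𝔄.piece_apply_of_not_mem v hy]
      have h2 : Tendsto (fun _ : ℕ => (0 : F)) atTop (𝓝 (g i y)) := by
        refine (hval i y).congr fun n => ?_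
        exact 𝔄.piece_apply_of_not_mem (u (φ n) : M → F) hy
      exact tendsto_nhds_unique tendsto_const_nhds h2
  refine ⟨φ, hφ, ⟨v, fun i => by rw [hpiece i]; exact (g i).memContDiffHolder⟩, fun i j hj => ?_, hv⟩
  have h : 𝔄.piece ((⟨v, fun i => by rw [hpiece i]; exact (g i).memContDiffHolder⟩ :
      HolderManifoldFunction 𝔄 F k r) : M → F) i = (g i : E → F) := hpiece i
  rw [h]
  exact hg i (Finset.mem_univ i) j hj

end HolderManifoldFunction

end Literature.Analysis.FunctionSpaces

end
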